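import Summits.ResolutionOfSingularities.ResolutionOfSingularities.Theses.JacobianBudget
import HarnessLib

/-!
# `JacobianBudget.Assembly` (stmt-ResolutionOfSingularities-18948) — PROVED

Route `ResolutionOfSingularities/JacobianBudget`. The route's assembly item is the implication

  `IsolatedJacobianDrop → JacobianDropToTermination → Steer → TorsorToLurelPerfect →
   PatchingRelPerfect → DescentPerfectToAll → ResolutionOfSingularities`,

which is, hypothesis for hypothesis, the route file's planner-authored deciding theorem
`Theses.JacobianBudget.closes` (`fun p hp => hD p hp (hP p hp (hT p hp (hS (hB hA) p hp)))`):
the one-step Jacobian drop feeds the budget argument `JacobianDropToTermination` to give the target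
`IsolatedForcedTermination`, and the steering chain shared verbatim with `FrobeniusClosing` /
`WildCones` carries it to the Statement. So the item holds by that theorem, with no open crux used.

(State of the route, for the reader: `JacobianDropToTermination` is CLOSED in the tree; the target
`IsolatedForcedTermination` (stmt-16343, shared with `FrobeniusClosing` / `WildCones` / `EscapeRate`)
is reached independently through `Theorems.WildCones.jacobianBudget_isolatedForcedTermination_of_classicalRegimes`
and `Theorems.WildCones.ClassicalRegimes_proof` (2026-08-26); `IsolatedJacobianDrop` (stmt-18946)
and the steering tail remain open items.)

This file replaces the role of no printed item; it is OURS (campaign res-hironaka, rung L, slot W4.1,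
chain w41): a kernel assembly of statements of this tree, NOT a statement of Hironaka's manuscript.
-/

noncomputable section

-- single-problem summit: the doubled namespace component `ResolutionOfSingularities` is forced
set_option linter.dupNamespace false

namespace Summit.ResolutionOfSingularities.ResolutionOfSingularities.Theorems.JacobianBudget

open Summit.ResolutionOfSingularities.ResolutionOfSingularities.Theses.JacobianBudget
  (IsolatedJacobianDrop JacobianDropToTermination Steer TorsorToLurelPerfect PatchingRelPerfect
    DescentPerfectToAll Assembly closes)

/-- **`JacobianBudget.Assembly` (item stmt-ResolutionOfSingularities-18948) holds**: the chain
`IsolatedJacobianDrop → JacobianDropToTermination → Steer → TorsorToLurelPerfect →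
PatchingRelPerfect → DescentPerfectToAll → ResolutionOfSingularities` is the route file's deciding
theorem `closes`. [folklore] -/
theorem assembly_proof : Assembly :=
  fun hA hB hS hT hP hD => closes hA hB hS hT hP hD

end Summit.ResolutionOfSingularities.ResolutionOfSingularities.Theorems.JacobianBudget

end
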